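import Literature.Geometry.Lorentzian.TeukolskyWhitingOperator
import Mathlib.Analysis.Calculus.MeanValue
import HarnessLib

/-!
# The Liouville potential `Ṽ` at the horizon: `Ṽ(x) = ω₀² + O(x − r₊)`
# (Teixeira da Costa 2020, Remark 3.9 (v), Lemma 4.1 (2))

Part of the proof programme for the named fact
`Literature.Geometry.Lorentzian.Kerr.Costa2019_realAxisModeStability` (R. Teixeira da Costa,
Commun. Math. Phys. 378 (2020) 705–781 = arXiv:1910.02854 [Costa2019], Thm. 4.1). The Liouville
potential `Ṽ` (`Costa2019.whitingPotential`) of the transformed equation `ũ'' + Ṽ ũ = 0` is a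
rational function of `x` whose apparent pole at `x = r₊` cancels; it extends smoothly across `r₊`
with value `ω₀² = ω² (r₊ − r₋)²/r₊²` there, hence `|Ṽ(x) − ω₀²| ≤ L (x − r₊)` near `r₊`
(`Costa2019.whitingPotential_sub_sq_le`). Along the tortoise coordinate this is the hypothesis
"`Ṽ − ω₀²` decays at an integrable rate as `x* → −∞`" of Lemma 4.1 (2) / Remark 3.9 (v) (combine
with `Costa2019.intervalIntegral_abs_comp_tortoise_le`), and `ω₀` is the frequency of the
asymptotics `ũ ∼ e^{−iω₀ x*}` at `x* → −∞` used in §4.2. Everything is proved; no named facts.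

## References
* R. Teixeira da Costa, CMP 378 (2020) 705–781, arXiv:1910.02854, Prop. 3.8, Remark 3.9 (v),
  Lemma 4.1, §4.2. [Costa2019]
-/

noncomputable section

open Complex Set Filter Topology

namespace Literature.Geometry.Lorentzian.Kerr

namespace Costa2019

/-- **Regular form of `Ṽ`.** On `(r₊, ∞)` the complex Liouville potential equals the manifestly
smooth expression `−h'A − h²ν' − A² + Δ Q̃/(x²+a²)²` with `A = hν` written out
(`A = xΔ/(x²+a²)² − s(x−r₊)/(x²+a²) − 2iMω(x−r₋)/(x²+a²) − iωΔ/(x²+a²)`,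
`h²ν' = Δ²(a²−x²)/(x²+a²)⁴ + s(x−r₊)²/(x²+a²)² + 2iMω(x−r₋)²/(x²+a²)²`): the factors `Δ`
cancel every pole at `r₊` and `r₋`. [cite: Costa2019, Remark 3.9 (v)] -/
theorem whitingPotentialC_eq_regular {M a : ℝ} (hM : 0 < M) (ha : |a| < M) (s ω m lam : ℝ)
    {x : ℝ} (hr : rPlus M a < x) :
    whitingPotentialC M a s ω m lam x =
      -(tortoiseHDeriv M a x : ℂ) *
          ((x : ℂ) * (delta M a x : ℂ) / ((x ^ 2 + a ^ 2 : ℝ) : ℂ) ^ 2 -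
            (s : ℂ) * ((x - rPlus M a : ℝ) : ℂ) / ((x ^ 2 + a ^ 2 : ℝ) : ℂ) -
            2 * I * M * ω * ((x - rMinus M a : ℝ) : ℂ) / ((x ^ 2 + a ^ 2 : ℝ) : ℂ) -
            I * ω * (delta M a x : ℂ) / ((x ^ 2 + a ^ 2 : ℝ) : ℂ)) -
        ((delta M a x : ℂ) ^ 2 * ((a ^ 2 - x ^ 2 : ℝ) : ℂ) / ((x ^ 2 + a ^ 2 : ℝ) : ℂ) ^ 4 +
          (s : ℂ) * ((x - rPlus M a : ℝ) : ℂ) ^ 2 / ((x ^ 2 + a ^ 2 : ℝ) : ℂ) ^ 2 +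
          2 * I * M * ω * ((x - rMinus M a : ℝ) : ℂ) ^ 2 / ((x ^ 2 + a ^ 2 : ℝ) : ℂ) ^ 2) -
        ((x : ℂ) * (delta M a x : ℂ) / ((x ^ 2 + a ^ 2 : ℝ) : ℂ) ^ 2 -
            (s : ℂ) * ((x - rPlus M a : ℝ) : ℂ) / ((x ^ 2 + a ^ 2 : ℝ) : ℂ) -
            2 * I * M * ω * ((x - rMinus M a : ℝ) : ℂ) / ((x ^ 2 + a ^ 2 : ℝ) : ℂ) -
            I * ω * (delta M a x : ℂ) / ((x ^ 2 + a ^ 2 : ℝ) : ℂ)) ^ 2 +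
        (delta M a x : ℂ) * heunQt M a s ω m lam x / ((x ^ 2 + a ^ 2 : ℝ) : ℂ) ^ 2 := by
  have hq : rMinus M a < x := (rMinus_le_rPlus M a).trans_lt hr
  have hx0 : 0 < x := (rPlus_pos hM a).trans hr
  have hp' : (x : ℂ) - (rPlus M a : ℂ) ≠ 0 := by
    rw [← Complex.ofReal_sub]; exact_mod_cast (sub_pos.2 hr).ne'
  have hq' : (x : ℂ) - (rMinus M a : ℂ) ≠ 0 := by
    rw [← Complex.ofReal_sub]; exact_mod_cast (sub_pos.2 hq).ne'
  have hX' : (x : ℂ) ^ 2 + (a : ℂ) ^ 2 ≠ 0 := by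
    have h : x ^ 2 + a ^ 2 ≠ 0 := by positivity
    exact_mod_cast h
  unfold whitingPotentialC tortoiseH liouvilleNu liouvilleNuDeriv
  rw [delta_eq_mul ha.le]
  push_cast
  field_simp
  ring

/-- **`Ṽ = ω₀² + O(x − r₊)` at the horizon**, `ω₀ = ω (r₊ − r₋)/r₊`: there are `x₁ > r₊` and
`L ≥ 0` with `|Ṽ(x) − ω₀²| ≤ L (x − r₊)` for `r₊ < x ≤ x₁`. (The value: near `r₊`,
`ν ≈ c/(x−r₊)`, `c = −2iMω`, `h ≈ h₁(x−r₊)`, `h₁ = (r₊−r₋)/(r₊²+a²)`, and the three pole terms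
`h'ν + hν' + hν²` of `Ṽ/(−h)` contribute `(h₁c − h₁c + h₁c²)/(x−r₊)`, so
`Ṽ(r₊) = −h₁²c² = (2Mωh₁)² = ω₀²` by `r₊² + a² = 2Mr₊`.) This is the integrable rate of
`Ṽ − ω₀²` at `x* = −∞` of Remark 3.9 (v) / Lemma 4.1 (2), and `ω₀` is the frequency of
`ũ ∼ (x − r₊)^{−2iMω} ∼ e^{−iω₀x*}` there. [cite: Costa2019, Remark 3.9 (v), Lemma 4.1 (2), §4.2] -/
theorem whitingPotential_sub_sq_le {M a : ℝ} (hM : 0 < M) (ha : |a| < M) (s ω m lam : ℝ) :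
    ∃ x₁ L : ℝ, rPlus M a < x₁ ∧ 0 ≤ L ∧ ∀ x, rPlus M a < x → x ≤ x₁ →
      |whitingPotential M a s ω m lam x - (ω * (rPlus M a - rMinus M a) / rPlus M a) ^ 2| ≤
        L * (x - rPlus M a) := by
  have hrp : 0 < rPlus M a := rPlus_pos hM a
  have hgap : 0 < rPlus M a - rMinus M a := sub_pos.2 (IsSubextremal.rMinus_lt_rPlus ha)
  -- the regular form as a globally smooth function of `x`
  set ρ : ℝ → ℂ := fun x => ((x ^ 2 + a ^ 2 : ℝ) : ℂ) with hρ
  set Δc : ℝ → ℂ := fun x => (delta M a x : ℂ) with hΔc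
  set A : ℝ → ℂ := fun x => (x : ℂ) * Δc x / ρ x ^ 2 - (s : ℂ) * ((x - rPlus M a : ℝ) : ℂ) / ρ x -
    2 * I * M * ω * ((x - rMinus M a : ℝ) : ℂ) / ρ x - I * ω * Δc x / ρ x with hA
  set V : ℝ → ℂ := fun x => -(tortoiseHDeriv M a x : ℂ) * A x -
    (Δc x ^ 2 * ((a ^ 2 - x ^ 2 : ℝ) : ℂ) / ρ x ^ 4 + (s : ℂ) * ((x - rPlus M a : ℝ) : ℂ) ^ 2 / ρ x ^ 2 +
      2 * I * M * ω * ((x - rMinus M a : ℝ) : ℂ) ^ 2 / ρ x ^ 2) -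
    A x ^ 2 + Δc x * heunQt M a s ω m lam x / ρ x ^ 2 with hV
  have hVeq : ∀ x, rPlus M a < x → whitingPotentialC M a s ω m lam x = V x := fun x hx => by
    rw [whitingPotentialC_eq_regular hM ha s ω m lam hx]
  -- smoothness of the building blocks on `U = (r₊/2, ∞)` (where `x > 0`, so `x² + a² > 0`)
  set U : Set ℝ := Ioi (rPlus M a / 2) with hU
  have hUo : IsOpen U := isOpen_Ioi
  have hUpos : ∀ x ∈ U, 0 < x := fun x hx => lt_trans (by positivity) (mem_Ioi.1 hx)
  have hρ0 : ∀ x ∈ U, ρ x ≠ 0 := fun x hx => by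
    have : (0 : ℝ) < x ^ 2 + a ^ 2 := by have := hUpos x hx; positivity
    show ((x ^ 2 + a ^ 2 : ℝ) : ℂ) ≠ 0
    exact_mod_cast this.ne'
  have hcR : ∀ {f : ℝ → ℝ}, ContDiffOn ℝ 1 f U → ContDiffOn ℝ 1 (fun x => (f x : ℂ)) U :=
    fun hf => Complex.ofRealCLM.contDiff.comp_contDiffOn hf
  have hρs : ContDiffOn ℝ 1 ρ U := hcR (by fun_prop)
  have hρi : ContDiffOn ℝ 1 (fun x => (ρ x)⁻¹) U := hρs.inv hρ0
  have hΔs : ContDiffOn ℝ 1 Δc U := hcR (by unfold delta; fun_prop)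
  have hxs : ContDiffOn ℝ 1 (fun x : ℝ => (x : ℂ)) U := hcR contDiffOn_id
  have hps : ContDiffOn ℝ 1 (fun x : ℝ => ((x - rPlus M a : ℝ) : ℂ)) U := hcR (by fun_prop)
  have hqs : ContDiffOn ℝ 1 (fun x : ℝ => ((x - rMinus M a : ℝ) : ℂ)) U := hcR (by fun_prop)
  have has : ContDiffOn ℝ 1 (fun x : ℝ => ((a ^ 2 - x ^ 2 : ℝ) : ℂ)) U := hcR (by fun_prop)
  have hh's : ContDiffOn ℝ 1 (fun x : ℝ => (tortoiseHDeriv M a x : ℂ)) U := by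
    refine hcR ?_
    unfold tortoiseHDeriv delta
    refine ContDiffOn.div (by fun_prop) (by fun_prop) fun x hx => ?_
    have : (0 : ℝ) < x ^ 2 + a ^ 2 := by have := hUpos x hx; positivity
    positivity
  have hQs : ContDiffOn ℝ 1 (fun x : ℝ => heunQt M a s ω m lam x) U := by
    unfold heunQt
    fun_prop
  -- rewrite divisions as multiplications by inverses to use `ContDiffOn.mul`
  have hdiv : ∀ {f : ℝ → ℂ} (k : ℕ), ContDiffOn ℝ 1 f U →
      ContDiffOn ℝ 1 (fun x => f x / ρ x ^ k) U := by
    intro f k hf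
    have : (fun x => f x / ρ x ^ k) = fun x => f x * ((ρ x)⁻¹) ^ k := by
      funext x; rw [div_eq_mul_inv, inv_pow]
    rw [this]; exact hf.mul (hρi.pow k)
  have hAs : ContDiffOn ℝ 1 A U := by
    simp only [hA]
    refine ((ContDiffOn.sub (ContDiffOn.sub ?_ ?_) ?_).sub ?_)
    · exact hdiv 2 (hxs.mul hΔs)
    · simpa using hdiv 1 (contDiffOn_const.mul hps)
    · simpa using hdiv 1 (contDiffOn_const.mul hqs)
    · simpa using hdiv 1 (contDiffOn_const.mul hΔs)
  have hVs : ContDiffOn ℝ 1 V U := by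
    simp only [hV]
    refine (((hh's.neg.mul hAs).sub ((ContDiffOn.add (ContDiffOn.add ?_ ?_) ?_))).sub
      (hAs.pow 2)).add ?_
    · exact hdiv 4 ((hΔs.pow 2).mul has)
    · exact hdiv 2 (contDiffOn_const.mul (hps.pow 2))
    · exact hdiv 2 (contDiffOn_const.mul (hqs.pow 2))
    · exact hdiv 2 (hΔs.mul hQs)
  -- the value at `r₊`
  have hV0 : V (rPlus M a) = (((ω * (rPlus M a - rMinus M a) / rPlus M a) ^ 2 : ℝ) : ℂ) := by
    have hΔ0 : delta M a (rPlus M a) = 0 := by rw [delta_eq_mul ha.le]; ring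
    have hρp : (rPlus M a) ^ 2 + a ^ 2 = 2 * M * rPlus M a := by
      have h1 := rPlus_mul_rMinus ha.le
      have h2 := rPlus_add_rMinus M a
      nlinarith
    have hρc : (rPlus M a : ℂ) ^ 2 + (a : ℂ) ^ 2 = 2 * M * rPlus M a := by exact_mod_cast hρp
    have ha2 : (a : ℂ) ^ 2 = 2 * M * rPlus M a - (rPlus M a : ℂ) ^ 2 := by
      linear_combination hρc
    have hsum : (rPlus M a : ℂ) + rMinus M a = 2 * M := by exact_mod_cast rPlus_add_rMinus M a
    have hrm : (rMinus M a : ℂ) = 2 * M - rPlus M a := by linear_combination hsum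
    have hr0 : (rPlus M a : ℂ) ≠ 0 := by exact_mod_cast hrp.ne'
    have hM0 : (M : ℂ) ≠ 0 := by exact_mod_cast hM.ne'
    have h2M : (2 : ℂ) * M * rPlus M a ≠ 0 := by
      have : (2 : ℂ) ≠ 0 := two_ne_zero
      exact mul_ne_zero (mul_ne_zero this hM0) hr0
    simp only [hV, hA, hΔc, hρ, hΔ0, tortoiseHDeriv, sub_self]
    push_cast
    rw [hrm, ha2]
    field_simp
    ring_nf
    simp only [Complex.I_sq]
    ring
  -- mean value theorem on `[r₊, r₊ + 1] ⊆ U`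
  have hsub : Icc (rPlus M a) (rPlus M a + 1) ⊆ U := fun x hx => by
    show rPlus M a / 2 < x
    linarith [hx.1]
  have hVd : ∀ x ∈ U, HasDerivAt V (deriv V x) x := fun x hx =>
    ((hVs.differentiableOn one_ne_zero) x hx).differentiableAt (hUo.mem_nhds hx) |>.hasDerivAt
  have hV'c : ContinuousOn (deriv V) U := hVs.continuousOn_deriv_of_isOpen hUo le_rfl
  obtain ⟨L₀, hL₀⟩ := isCompact_Icc.exists_bound_of_continuousOn (hV'c.mono hsub)
  have hmvt := norm_image_sub_le_of_norm_deriv_le_segment' (f := V) (a := rPlus M a)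
    (b := rPlus M a + 1) (fun x hx => (hVd x (hsub hx)).hasDerivWithinAt)
    (fun x hx => (hL₀ x (Ico_subset_Icc_self hx)).trans (le_abs_self L₀))
  refine ⟨rPlus M a + 1, |L₀|, by linarith, abs_nonneg _, fun x hx hx1 => ?_⟩
  have h1 := hmvt x ⟨hx.le, hx1⟩
  have hre : whitingPotential M a s ω m lam x - (ω * (rPlus M a - rMinus M a) / rPlus M a) ^ 2 =
      (V x - V (rPlus M a)).re := by
    rw [Complex.sub_re, hV0, Complex.ofReal_re, whitingPotential, hVeq x hx]
  rw [hre]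
  exact (Complex.abs_re_le_norm _).trans h1

/-- `Ṽ` is continuous on `(r₊, ∞)`. [folklore] -/
theorem continuousOn_whitingPotential {M a : ℝ} (hM : 0 < M) (ha : |a| < M) (s ω m lam : ℝ) :
    ContinuousOn (whitingPotential M a s ω m lam) (Ioi (rPlus M a)) := by
  have hc : ContinuousOn (whitingPotentialC M a s ω m lam) (Ioi (rPlus M a)) := by
    intro x hx
    have hx' : rPlus M a < x := hx
    have hq : rMinus M a < x := (rMinus_le_rPlus M a).trans_lt hx'
    have hx0 : 0 < x := (rPlus_pos hM a).trans hx'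
    have hX : x ^ 2 + a ^ 2 ≠ 0 := by positivity
    have hp : ((x - rPlus M a : ℝ) : ℂ) ≠ 0 := by exact_mod_cast (sub_pos.2 hx').ne'
    have hq' : ((x - rMinus M a : ℝ) : ℂ) ≠ 0 := by exact_mod_cast (sub_pos.2 hq).ne'
    have hXc : ((x ^ 2 + a ^ 2 : ℝ) : ℂ) ≠ 0 := by exact_mod_cast hX
    have hΔ : (delta M a x : ℂ) ≠ 0 := by exact_mod_cast (delta_pos ha.le hx').ne'
    have hX2 : (x ^ 2 + a ^ 2) ^ 2 ≠ 0 := pow_ne_zero 2 hX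
    have hXc2 : ((x ^ 2 + a ^ 2 : ℝ) : ℂ) ^ 2 ≠ 0 := pow_ne_zero 2 hXc
    have hp2 : ((x - rPlus M a : ℝ) : ℂ) ^ 2 ≠ 0 := pow_ne_zero 2 hp
    have hq2 : ((x - rMinus M a : ℝ) : ℂ) ^ 2 ≠ 0 := pow_ne_zero 2 hq'
    unfold whitingPotentialC tortoiseH tortoiseHDeriv liouvilleNu liouvilleNuDeriv heunQt delta
    apply ContinuousAt.continuousWithinAt
    unfold delta at hΔ
    fun_prop (disch := assumption)
  intro x hx
  exact (Complex.continuous_re.continuousAt.comp_continuousWithinAt (hc x hx)).congr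
    (fun y _ => rfl) rfl

end Costa2019

end Literature.Geometry.Lorentzian.Kerr

end
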